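import Literature.MathematicalPhysics.QuantumFieldTheory.Balaban1983to89.B8Prop3GaugeFixedKLevelSrc
import Literature.MathematicalPhysics.QuantumFieldTheory.Balaban1983to89.B8Prop3KLevelGamma

/-!
# `Balaban1983to89.B8Prop3GaugeFixedKLevelSrcGamma` — [Balaban1985RegularSpaces] Sect. H, p. 101 (Theorem 8's sourced gauge condition (1.146)):
# `B8Prop3GaugeFixedKLevelSrc` (Prop. 3's sourced reset (1.59) ⇒ (1.62) + Theorem 4's existence induction for an arbitrary gauge predicate `Lan`)
# IN EDITION γ — the averaging-datum class `Λb` a PARAMETER under PRINT's box law «box ⊂ Ω_{j−1}» ((1.31) p. 82: the crossing contours live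
# one collar further out), the [3]-Prop.-4 windows at `(L²α₀, L·α₂)`, the (1.56) step by dag-n05-w1's `B8Prop3KLevelGamma.wsup_B1_le_kLevel_γ`,
# the (1.42) clause by dag-n05-e's `B8Eq142KLevelLocalGamma.H42_of_inAx_γ` — D7-1 of the `Ω₀ = ℤᵈ` road's γ chain (plan START-LIST v3 §n05)

statement-level skeleton of published theorems with citation tags; proofs where landed; nothing here is a claim about the Yang–Mills mass gap

T. Bałaban, *Spaces of regular gauge field configurations on a lattice and gauge fixing conditions*, Commun. Math. Phys. **99** (1985) 75–102
`[Balaban1985RegularSpaces]` ("B8"): Prop. 3 p. 87, (1.55)–(1.62) pp. 86–87, Thm 4 p. 88, pp. 94–95, Thm 8 (1.146) p. 101 («Inspecting the proofs of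
the theorems and propositions we can see easily that they work in this more general situation almost without any changes, only some constants
change their numerical values»), (1.31) p. 82 (inner AND crossing constraint bonds), p. 77 (bond convention).  PDF held:
`paper:balaban1985-cmp99-regular-spaces-gauge-fixing` (journal page = PDF page + 74).

CITATION HEADER (lean-in-tree rule).  Cell `pub-ymgap` (HUMAN RULING D-0062, Track A), DAG node N05 = [B8], seat `pub-ymgap-dag-n05-d` (g10; R134 row
s2; the `Ω₀ = ℤᵈ` road).  WHY THIS FILE.  The typed bond class of a `ZdIdx` member (`ZdIdx.hbox` «box ⊂ Ω_j», law №12 `towerBonds`) carries no crossing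
bond, so every (1.59)∕(1.42)-type statement keyed on it is VACUOUS or FALSE above truncation 0 (dag-n05-c `B8Ineq159FlatShellModeVacuity` p572834,
`B8SockB9P3ShellModeVacuityUniv` p576185; this seat `B8Prop3ShellModeVacuity` p585094 — the N05 slot `B8LeafOfRecordSubBH` is EMPTY as typed).  The repair
of record is CLASS-AS-PARAMETER («edition γ»): dag-n05-c's `cubeLamBP`, this seat's `B8TowerBondsPrinted.towerBondsP` (p582555), dag-n06-b's γ suppliers
(p579891 ∕ p580942), dag-n05-e's γ driver (`B8Eq142KLevelLocalGamma` p580875, `B8Thm4KLevelGamma`), dag-n05-w1's `B8Prop3KLevelGamma` (p583708).  THIS FILE is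
the γ twin of this seat's `B8Prop3GaugeFixedKLevelSrc` (Theorem 8's existence core on the concrete carriers): the same three theorems with the datum
class under print's law, consumed downstream by the γ twins of `B8Prop3SrcZd3(H)` ∕ `B8Thm8SurvivingZd3Map(HE)` (D7) and by the P-carrier knits (D9).

WHAT THIS FILE PROVES (theorems only, no `def`; proofs = the originals' with the γ lemmas BY NAME).
§1 `prop3_normA_kLevel_src_γ` — (1.40)–(1.42) + (1.61) ⇒ (1.62) in norm form for the `|A|`- and gradient lines with additive source terms `S_a, S_g`,
   class `Λ` under «box ⊂ Ω_{j−1}» ((1.55) `eq155_norm_kLevel_hermitian`, (1.56) `wsup_B1_le_kLevel_γ`, `apriori_160_src`, `B8.apriori_162`).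
§2 `hP3_gaugeFixed_of_b9_src_γ` — the socket `hP3` of Theorem 4's induction with the sourced in-edge, edition γ (masked-exponent device verbatim).
§3 ★★ `thm4_exists_all_levels_supp_src_γ` — Theorem 4's existence clause at all levels for an arbitrary `Lan` with the sourced reset, edition γ:
   `B8Thm4SupportLocal.thm4_exists_all_levels_supp` (datum-agnostic) + §2 + `H42_of_inAx_γ` ((1.35) `h135` guarded by «box ⊂ Ω_{j−1}», windows `h16γ`).
The uniqueness §5 of the original (`thm4_unique_leafShape_lan`, `thm4_unique_eq_lan`) does not read the class and is NOT re-typed (use the original).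

HONEST SCOPE.  Assemblies BY NAME over landed modules; nothing of Propositions 3∕5, (1.42), (1.59) is proved; the sourced in-edge `H59src`, the (1.42)
feed and Prop. 5's sockets are HYPOTHESES (object-bound: [4] Thm 3.3 with source at print's class — dag-n06-b's γ suppliers deliver the univ-road shape
at any class, A6-witnessed at truncation 0 only); the class laws are hypotheses on the parameter `Λb` (inhabited by `towerBondsP` ∕ `cubeLamBP'`).
`≤` where print has `<`; `T_η ↦ ℤᵈ`.  Count-neutral; N05 NOT discharged; one finite `T⁴` programme at fixed `ε`, Bałaban as printed — nothing continuum ∕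
ℝ⁴ ∕ OS ∕ mass-gap ∕ Clay.  No `sorry`, no `def`, no `instance`, no `notation`.  Unit `pub-ymgap-dag-n05-d` (g10), 2026-08-27.
-/

noncomputable section

open NormedSpace

namespace Literature.MathematicalPhysics.QuantumFieldTheory.Balaban1983to89.B8Prop3GaugeFixedKLevelSrcGamma

open Complex (I I_ne_zero)
open MatrixLog B7Prop1Explicit B7Prop2Explicit B7Prop1Local B7Eq92Concrete
open B7Prop2Explicit (C0 c2' unitaryUnits unitaryUnits_le_U1 avgClosed_unitaryUnits)
open B8Lemma1NonAbelian (mulCfg)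
open B8Ineq132 (covDerivFwd covDeriv covDiv plaqF InAk CondAt BondTouches PlaqTouches)
open B8Eq140Level (SideTouches)
open B8Eq119TwistedAxial (Restr129 InAx)
open B8Eq184Proof (gaugeExp cfgExp)
open B8Eq146AExpansion (iEta expCfg)
open B7Prop4GeneralLevels (logCovIter linCovIter)
open B8Eq155JBound (Jcur wsup)
open B8ScaledSupNorm (bondNorm msup weight Bdd)
open B7Prop3Flat (c3)
open B7Eq78Linearization (conjR)
open B8Thm2LogB (blockTop)
open B8Ineq130 (tlo thi)
open B8Eq155KLevelLocal (eq155_norm_kLevel_hermitian)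
open B8Prop3KLevelGamma (wsup_B1_le_kLevel_γ)
open B8Prop3KLevel (bound_of_sideTouches)
open B8Prop3GaugeFixedKLevel (logField_spec mem_unitaryUnits_of_mgauge_eq cfgExp_congr_at inAk_congr_of_sideTouches
  mulCfg_eq_gaugeAct_of_mgauge_eq expCfg_iEta_eq_cfgExp)
open B8Prop3GaugeFixedKLevelSrc (apriori_160_src)
open B8Thm4SupportLocal (thm4_exists_all_levels_supp)
open B8Eq140Level (sideTouches_of_bondTouches)

-- `Site` alone could resolve to the torus sites of `Setup.lean`; re-export the `ℤ^d` sites of `B7Prop1Explicit`.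
export B7Prop1Explicit (Site)

variable {d : ℕ}

/-! ## §1 Proposition 3 in norm form at `k` levels with the sourced (1.59), edition γ -/

section Prop3

variable {𝔸 : Type*} [CStarAlgebra 𝔸] [Nontrivial 𝔸]

/-- **PROPOSITION 3 IN NORM FORM AT `k` LEVELS WITH A SOURCED (1.59), EDITION γ** (the constraint-bond class `Λ` under PRINT's box law «box ⊂ Ω_{j−1}», windows at `(L²α₀, L·α₂)`, (1.56) by dag-n05-w1's `B8Prop3KLevelGamma.wsup_B1_le_kLevel_γ`, (1.61)-constant `C₂ ≥ 8·131072(d+1)²e^{…L²α₀}L²`) — n05-b's `B8Prop3KLevel.prop3_norms_kLevel` for the `|A|`-quantity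
`a` and the gradient quantity `g` when the in-edge (1.59) carries additive source terms `S_a, S_g ≥ 0` (print p. 101: for the sourced gauge
condition (1.146) «only some constants change their numerical values»): same hypotheses — (1.40) for `U₀` and `e^{iηA}U₀`, (1.41) on the sides
touching `Ω_j`, the gradient datum, (1.42) on the constraint bonds, the windows and (1.61) — and conclusions `a ≤ 5dLB₀(α₀ + α₁) + (S_a + S_g)`,
`g ≤ 5dLB₀(α₀ + α₁) + 2S_g`.  Proof = the original's: (1.55) `B8Eq155KLevelLocal.eq155_norm_kLevel_hermitian`, (1.56)
`B8Eq156KLevelLocal.wsup_B1_le_kLevel`, the sourced bootstrap `apriori_160_src`, (1.61) ⇒ (1.62) `B8.apriori_162`.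
[cite: Balaban1985RegularSpaces, Prop. 3 p.87, (1.55)–(1.62) pp.86–87, Thm 8 p.101] -/
theorem prop3_normA_kLevel_src_γ (hd2 : 2 ≤ d) {η : ℝ} (hη : 0 < η) {L : ℕ} (hL : 2 ≤ L) {k : ℕ}
    {U₀ : Site d → Fin d → 𝔸ˣ} (hU₀ : ∀ y κ, U₀ y κ ∈ unitaryUnits 𝔸)
    {A : Site d → Fin d → 𝔸} (hAh : ∀ y κ, IsSelfAdjoint (A y κ)) {α₀ α₁ α₂ g : ℝ}
    (hα₀ : 0 < α₀) (hα₁ : 0 ≤ α₁) (hα₂ : 0 ≤ α₂) (hg0 : 0 ≤ g)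
    -- [3] Prop. 4's linearisation windows ONE LEVEL LOWER (edition γ: the box of a level-`j` datum bond lies in `Ω_{j−1}`)
    (hα3 : C0 d * ((L : ℝ) ^ 2 * α₀) ≤ 1 / 3) (hα4 : 4 * ((L : ℝ) ^ 2 * α₀) ≤ c2' d L)
    (h16 : 16 * α₂ ≤ 1) (hd5 : 5 * α₂ * ((d : ℝ) - 1) ≤ 4)
    (hsmall : Real.exp (4 * (800 * ((d : ℝ) + 1) ^ 2 * ((d : ℝ) + 4)) * ((L : ℝ) ^ 2 * α₀))
      * (1 + 8 * (131072 * ((d : ℝ) + 1) ^ 2) * ((L : ℝ) * α₂)) ≤ 2)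
    (hc₃ : 2 * ((L : ℝ) * α₂) ≤ c3 d L) {B₀ : ℝ} (hB₀ : 0 ≤ B₀) (hside : 36 * d * B₀ * α₂ ≤ 1 / 2) (h50 : 50 * d * α₂ ≤ 1)
    {C₂ : ℝ} (hC₂ : 8 * (131072 * ((d : ℝ) + 1) ^ 2) * Real.exp (4 * (800 * ((d : ℝ) + 1) ^ 2 * ((d : ℝ) + 4)) * ((L : ℝ) ^ 2 * α₀))
      * (L : ℝ) ^ 2 ≤ C₂)
    (h61 : 2 * α₂ ^ 2 + 20 * d * α₀ * α₂ + 2 * C₂ * α₂ ^ 2 ≤ α₀ + α₁)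
    {Ω : ℕ → Set (Site d)} {Λ : ℕ → Set (Site d × Fin d)}
    (hbox : ∀ j, j ≤ k → ∀ c ∈ Λ j, ∀ x, InBox (loK L j c.1) (bondHiK L j c.1 c.2) x → x ∈ Ω (j - 1))
    (h40₀ : InAk L k η α₀ Ω U₀) (h40₁ : InAk L k η α₀ Ω (mulCfg (expCfg (iEta η A)) U₀))
    (h41 : ∀ j, j ≤ k → ∀ y τ, SideTouches (Ω j) y τ → ‖A y τ‖ ≤ α₂ * ((L : ℝ) ^ j * η)⁻¹)
    (hg : ∀ j, j ≤ k → ∀ (y : Site d) (κ τ : Fin d), SideTouches (Ω j) y τ →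
      ((L : ℝ) ^ j * η) ^ 2 * ‖covDerivFwd η U₀ κ (fun z => A z τ) y‖ ≤ g)
    (h42 : ∀ j, j ≤ k → ∀ c ∈ Λ j, ‖logCovIter L U₀ (iEta η A) j c.1 c.2‖ < 2 * d * L * α₁)
    {a Sa Sg : ℝ}
    (h59a : a ≤ B₀ * (bondNorm L k η (-(3 : ℝ)) Ω (fun x μ => Jcur η U₀ A μ x)
      + wsup 1 (fun p : {p : ℕ × (Site d × Fin d) // p.1 ≤ k ∧ p.2 ∈ Λ p.1} =>
          linCovIter L U₀ (iEta η A) p.1.1 p.1.2.1 p.1.2.2)) + Sa)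
    (h59g : g ≤ B₀ * (bondNorm L k η (-(3 : ℝ)) Ω (fun x μ => Jcur η U₀ A μ x)
      + wsup 1 (fun p : {p : ℕ × (Site d × Fin d) // p.1 ≤ k ∧ p.2 ∈ Λ p.1} =>
          linCovIter L U₀ (iEta η A) p.1.1 p.1.2.1 p.1.2.2)) + Sg) :
    a ≤ 5 * d * L * B₀ * (α₀ + α₁) + (Sa + Sg) ∧ g ≤ 5 * d * L * B₀ * (α₀ + α₁) + 2 * Sg := by
  have hL1 : 1 ≤ L := le_trans (by norm_num) hL
  have h₀ : ∀ y κ, U₀ y κ ∈ U1 𝔸 := fun y κ => unitaryUnits_le_U1 (hU₀ y κ)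
  -- (1.55) at `k` levels (`B8Eq155KLevelLocal`)
  have h55 := eq155_norm_kLevel_hermitian hη hL1 h₀ hAh hα₀.le hα₂ h16 hd5 hg0 h40₀ h40₁ h41 hg
  -- (1.56) at `k` levels (`B8Eq156KLevelLocal`), with (1.41) moved to the bonds touching `Ω_j`
  have h41' : ∀ j, j ≤ k → ∀ x μ, BondTouches (Ω j) x μ → ‖A x μ‖ ≤ α₂ * ((L : ℝ) ^ j * η)⁻¹ :=
    fun j hj x μ hb => bound_of_sideTouches hd2 (h41 j hj) x μ hb
  have h56' := wsup_B1_le_kLevel_γ hη L hL (avgClosed_unitaryUnits d L) U₀ hU₀ hα₀ hα3 hα4 A hα₂ hsmall hc₃ hbox h40₀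
    h41' hα₁ h42
  have h56 : wsup 1 (fun p : {p : ℕ × (Site d × Fin d) // p.1 ≤ k ∧ p.2 ∈ Λ p.1} =>
        linCovIter L U₀ (iEta η A) p.1.1 p.1.2.1 p.1.2.2)
      ≤ 2 * d * L * α₁ + (8 * (131072 * ((d : ℝ) + 1) ^ 2)
          * Real.exp (4 * (800 * ((d : ℝ) + 1) ^ 2 * ((d : ℝ) + 4)) * ((L : ℝ) ^ 2 * α₀)) * (L : ℝ) ^ 2) * α₂ ^ 2 := by
    refine h56'.trans (le_of_eq ?_); ring
  -- the bootstrap (1.55) + (1.56) + (1.59) ⇒ (1.60), with `C₂(d, α₀)`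
  obtain ⟨ha, hg'⟩ := apriori_160_src (Nat.cast_nonneg d) hB₀ hα₂ hg0 h55 h56 h59a h59g hside h50
  -- `C₂(d, α₀) ≤ C₂`, so (1.60) holds with `C₂`
  set R₀ := B₀ * (4 * α₀ + 4 * d * L * α₁ + 2 * α₂ ^ 2 + 20 * d * α₀ * α₂
      + 2 * (8 * (131072 * ((d : ℝ) + 1) ^ 2) * Real.exp (4 * (800 * ((d : ℝ) + 1) ^ 2 * ((d : ℝ) + 4)) * ((L : ℝ) ^ 2 * α₀))
        * (L : ℝ) ^ 2) * α₂ ^ 2) with hR₀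
  set R₁ := B₀ * (4 * α₀ + 4 * d * L * α₁ + 2 * α₂ ^ 2 + 20 * d * α₀ * α₂ + 2 * C₂ * α₂ ^ 2) with hR₁
  have hR : R₀ ≤ R₁ := by
    rw [hR₀, hR₁]
    apply mul_le_mul_of_nonneg_left _ hB₀
    have hsq : 0 ≤ α₂ ^ 2 := sq_nonneg _
    nlinarith [mul_le_mul_of_nonneg_right hC₂ hsq]
  -- (1.60) + (1.61) ⇒ (1.62) (`B8.apriori_162`)
  have hd' : (1 : ℝ) ≤ d := by exact_mod_cast (le_trans (by norm_num) hd2)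
  have hdL : (1 : ℝ) ≤ (d : ℝ) * L := by
    have hL' : (1 : ℝ) ≤ L := by exact_mod_cast hL1
    nlinarith
  have h162 : R₁ ≤ 5 * d * L * B₀ * (α₀ + α₁) := by
    rw [hR₁]
    exact B8.apriori_162 hB₀ hdL hα₀.le hα₁ h61
  exact ⟨by linarith [hR.trans h162], by linarith [hR.trans h162]⟩

end Prop3

/-! ## §2 The socket `hP3` with the SOURCED in-edge, edition γ -/

section Reset

variable {𝔸 : Type*} [CStarAlgebra 𝔸] [Nontrivial 𝔸]

/-- **THE SOCKET `hP3` OF `B8Thm4InductionLocal.thm4_exists_all_levels` WITH A SOURCED IN-EDGE, EDITION γ** (datum class `Λb` a parameter under print's law «box ⊂ Ω_{j−1}»; the sourced twin of dag-n05-e's `B8Thm4KLevelGamma.hP3_gaugeFixed_of_b9_γ`) — n04-b's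
`B8Prop3GaugeFixedKLevel.hP3_gaugeFixed_of_b9` VERBATIM (statement, masked-exponent device, proof) except: the in-edge `H59src` bounds the
`|A′|₍₋₁₎`-family by `B₀(|J|₍₋₃₎ + sup|Q A′|) + T_a` and the gradient family by `… + T_g` (`T_a, T_g ≥ 0` uniform in the level and the
gauge-fixed field — for Theorem 8 the `|f|`-contribution of [4] Thm 3.3 applied to (1.146)), and the reset constant is ANY `c⋆` with
`5dLB₀(α₀ + α₁) + T_a + T_g ≤ c⋆` (`hc`; the windows stay stated in `c⋆`).  CONCLUSION unchanged: for `1 ≤ m ≤ k` and gauge-fixed `(u, W, A)` with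
`Lan m W` and `‖A_b‖ ≤ (2Lc⋆ + 8α₄)(Lʲη)⁻¹` on the sides touching `Ω_j`, `j ≤ m`: `‖A_b‖ ≤ c⋆(Lʲη)⁻¹` there.  Print p. 101: «only some
constants change their numerical values». [cite: Balaban1985RegularSpaces, Prop. 3 p.87, (1.59)–(1.62) pp.86–87, Thm 4 p.88, p.95, Thm 8 p.101] -/
theorem hP3_gaugeFixed_of_b9_src_γ (hd2 : 2 ≤ d) {η : ℝ} (hη : 0 < η) {L : ℕ} (hL : 2 ≤ L) (k : ℕ)
    {U₀ U' : Site d → Fin d → 𝔸ˣ} (hU₀ : ∀ x κ, U₀ x κ ∈ unitaryUnits 𝔸) (hU' : ∀ x κ, U' x κ ∈ unitaryUnits 𝔸)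
    {α₀ α₁ α₄ B₀ cstar : ℝ} (hα₀ : 0 < α₀) (hα₁ : 0 ≤ α₁) (hα₄ : 0 ≤ α₄) (hB₀ : 0 ≤ B₀)
    {Ta Tg : ℝ} (hTa : 0 ≤ Ta) (hTg : 0 ≤ Tg) (hc : 5 * d * L * B₀ * (α₀ + α₁) + (Ta + Tg) ≤ cstar)
    -- [3] Prop. 4's linearisation windows ONE LEVEL LOWER (edition γ)
    (hα3 : C0 d * ((L : ℝ) ^ 2 * α₀) ≤ 1 / 3) (hα4 : 4 * ((L : ℝ) ^ 2 * α₀) ≤ c2' d L)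
    (h16 : 16 * (2 * (L * cstar) + 8 * α₄) ≤ 1) (hd5 : 5 * (2 * (L * cstar) + 8 * α₄) * ((d : ℝ) - 1) ≤ 4)
    (hsmall : Real.exp (4 * (800 * ((d : ℝ) + 1) ^ 2 * ((d : ℝ) + 4)) * ((L : ℝ) ^ 2 * α₀))
      * (1 + 8 * (131072 * ((d : ℝ) + 1) ^ 2) * ((L : ℝ) * (2 * (L * cstar) + 8 * α₄))) ≤ 2)
    (hc₃ : 2 * ((L : ℝ) * (2 * (L * cstar) + 8 * α₄)) ≤ c3 d L) (hside : 36 * d * B₀ * (2 * (L * cstar) + 8 * α₄) ≤ 1 / 2)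
    (h50 : 50 * d * (2 * (L * cstar) + 8 * α₄) ≤ 1)
    {C₂ : ℝ} (hC₂ : 8 * (131072 * ((d : ℝ) + 1) ^ 2) * Real.exp (4 * (800 * ((d : ℝ) + 1) ^ 2 * ((d : ℝ) + 4)) * ((L : ℝ) ^ 2 * α₀)) * (L : ℝ) ^ 2 ≤ C₂)
    (h61 : 2 * (2 * (L * cstar) + 8 * α₄) ^ 2 + 20 * d * α₀ * (2 * (L * cstar) + 8 * α₄)
      + 2 * C₂ * (2 * (L * cstar) + 8 * α₄) ^ 2 ≤ α₀ + α₁)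
    (Ω : ℕ → Set (Site d)) (Λs : ℕ → ℕ → Set (Site d)) (Λb : ℕ → ℕ → Set (Site d × Fin d))
    -- PRINT's box law (edition γ): the locality box of a level-`j` datum bond lies in `Ω_{j−1}` ((1.31); level 0: `Ω₀`)
    (hbox : ∀ m, m ≤ k → ∀ j, j ≤ m → ∀ c ∈ Λb m j, ∀ x, InBox (loK L j c.1) (bondHiK L j c.1 c.2) x → x ∈ Ω (j - 1))
    (h33 : InAk L k η α₀ Ω U₀) (h34 : InAk L k η α₀ Ω (mulCfg U' U₀))
    (Lan : ℕ → (Site d → Fin d → 𝔸ˣ) → Prop)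
    (H42 : ∀ m, 1 ≤ m → m ≤ k → ∀ (u : Site d → 𝔸ˣ) (W : Site d → Fin d → 𝔸ˣ) (A' : Site d → Fin d → 𝔸),
      (∀ x, u x ∈ unitaryUnits 𝔸) → mgauge U₀ u W = U' → Restr129 L m (Λs m) U₀ u → Lan m W →
      (∀ y τ, IsSelfAdjoint (A' y τ)) →
      (∀ j, j ≤ m → ∀ y τ, SideTouches (Ω j) y τ →
        W y τ = cfgExp η A' y τ ∧ ‖A' y τ‖ ≤ (2 * (L * cstar) + 8 * α₄) * ((L : ℝ) ^ j * η)⁻¹) →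
      (∀ y τ, (∀ j, j ≤ m → ¬ SideTouches (Ω j) y τ) → A' y τ = 0) →
      ∀ j, j ≤ m → ∀ c ∈ Λb m j, ‖logCovIter L U₀ (iEta η A') j c.1 c.2‖ < 2 * d * L * α₁)
    (H59 : ∀ m, 1 ≤ m → m ≤ k → ∀ (u : Site d → 𝔸ˣ) (W : Site d → Fin d → 𝔸ˣ) (A' : Site d → Fin d → 𝔸),
      (∀ x, u x ∈ unitaryUnits 𝔸) → mgauge U₀ u W = U' → Restr129 L m (Λs m) U₀ u → Lan m W →
      (∀ y τ, IsSelfAdjoint (A' y τ)) →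
      (∀ j, j ≤ m → ∀ y τ, SideTouches (Ω j) y τ →
        W y τ = cfgExp η A' y τ ∧ ‖A' y τ‖ ≤ (2 * (L * cstar) + 8 * α₄) * ((L : ℝ) ^ j * η)⁻¹) →
      (∀ y τ, (∀ j, j ≤ m → ¬ SideTouches (Ω j) y τ) → A' y τ = 0) →
      msup L m η (-(1 : ℝ)) (fun j (b : Site d × Fin d) => SideTouches (Ω j) b.1 b.2) (fun b => A' b.1 b.2)
          ≤ B₀ * (bondNorm L m η (-(3 : ℝ)) Ω (fun x μ => Jcur η U₀ A' μ x)
            + wsup 1 (fun p : {p : ℕ × (Site d × Fin d) // p.1 ≤ m ∧ p.2 ∈ Λb m p.1} =>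
                linCovIter L U₀ (iEta η A') p.1.1 p.1.2.1 p.1.2.2)) + Ta ∧
        msup L m η (-(2 : ℝ)) (fun j (t : Fin d × Fin d × Site d) => SideTouches (Ω j) t.2.2 t.2.1)
            (fun t => covDerivFwd η U₀ t.1 (fun z => A' z t.2.1) t.2.2)
          ≤ B₀ * (bondNorm L m η (-(3 : ℝ)) Ω (fun x μ => Jcur η U₀ A' μ x)
            + wsup 1 (fun p : {p : ℕ × (Site d × Fin d) // p.1 ≤ m ∧ p.2 ∈ Λb m p.1} =>
                linCovIter L U₀ (iEta η A') p.1.1 p.1.2.1 p.1.2.2)) + Tg) :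
    ∀ m, 1 ≤ m → m ≤ k → ∀ (u : Site d → 𝔸ˣ) (W : Site d → Fin d → 𝔸ˣ) (A : Site d → Fin d → 𝔸),
      (∀ x, u x ∈ unitaryUnits 𝔸) → mgauge U₀ u W = U' → Restr129 L m (Λs m) U₀ u → Lan m W →
      (∀ j, j ≤ m → ∀ b ∈ {b : Site d × Fin d | SideTouches (Ω j) b.1 b.2},
        W b.1 b.2 = cfgExp η A b.1 b.2 ∧ ‖A b.1 b.2‖ ≤ (2 * (L * cstar) + 8 * α₄) * ((L : ℝ) ^ j * η)⁻¹) →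
      ∀ j, j ≤ m → ∀ b ∈ {b : Site d × Fin d | SideTouches (Ω j) b.1 b.2},
        ‖A b.1 b.2‖ ≤ cstar * ((L : ℝ) ^ j * η)⁻¹ := by
  intro m hm1 hmk u W A hu hW h129 hLan hWA j₀ hj₀ b₀ hb₀
  have hL1 : 1 ≤ L := le_trans (by norm_num) hL
  have hLr : (1 : ℝ) ≤ L := by exact_mod_cast hL1
  set α₂ : ℝ := 2 * (L * cstar) + 8 * α₄ with hα₂_def
  have hcstar : 0 ≤ cstar := le_trans (by positivity) hc
  have hα₂ : 0 ≤ α₂ := by positivity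
  have hα₂16 : α₂ ≤ 1 / 16 := by linarith
  -- `W` is unitary-valued
  have hWu : ∀ x κ, W x κ ∈ unitaryUnits 𝔸 := mem_unitaryUnits_of_mgauge_eq hU₀ hU' hu hW
  -- the bonds where the socket delivers `W = e^{iηA}`
  set M : Set (Site d × Fin d) := {b | ∃ j, j ≤ m ∧ SideTouches (Ω j) b.1 b.2} with hM_def
  -- the masked exponent field `A′ := (1/iη) log W` on `M`, `0` elsewhere
  set A' : Site d → Fin d → 𝔸 :=
    fun y τ => M.indicator (fun b : Site d × Fin d => η⁻¹ • ((I⁻¹ : ℂ) • mlog ((W b.1 b.2 : 𝔸ˣ) : 𝔸))) (y, τ) with hA'_def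
  -- on a socket bond: `A′ = A`, self-adjoint, `W = e^{iηA′}`
  have hsock : ∀ j, j ≤ m → ∀ y τ, SideTouches (Ω j) y τ →
      A' y τ = A y τ ∧ IsSelfAdjoint (A' y τ) ∧ W y τ = cfgExp η A' y τ := by
    intro j hj y τ hs
    have hmem : (y, τ) ∈ M := ⟨j, hj, hs⟩
    obtain ⟨hWA₁, hA₁⟩ := hWA j hj (y, τ) hs
    have hLj : (1 : ℝ) ≤ (L : ℝ) ^ j := one_le_pow₀ hLr
    have hA₂ : ‖A y τ‖ ≤ α₂ * η⁻¹ := by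
      calc ‖A y τ‖ ≤ α₂ * ((L : ℝ) ^ j * η)⁻¹ := hA₁
        _ = α₂ * η⁻¹ * ((L : ℝ) ^ j)⁻¹ := by rw [mul_inv]; ring
        _ ≤ α₂ * η⁻¹ * 1 := by
            apply mul_le_mul_of_nonneg_left (inv_le_one_of_one_le₀ hLj) (by positivity)
        _ = α₂ * η⁻¹ := mul_one _
    obtain ⟨hlog, hsa, hexp⟩ := logField_spec hη U₀ hWu hWA₁ hA₂ hα₂16
    have hA'y : A' y τ = η⁻¹ • ((I⁻¹ : ℂ) • mlog ((W y τ : 𝔸ˣ) : 𝔸)) := by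
      simp only [hA'_def, Set.indicator_of_mem hmem]
    refine ⟨by rw [hA'y, hlog], by rw [hA'y]; exact hsa, ?_⟩
    rw [hexp]
    exact cfgExp_congr_at η hA'y.symm
  have hA'0 : ∀ y τ, (∀ j, j ≤ m → ¬ SideTouches (Ω j) y τ) → A' y τ = 0 := by
    intro y τ h
    have hnot : (y, τ) ∉ M := fun ⟨j, hj, hs⟩ => h j hj hs
    simp only [hA'_def, Set.indicator_of_notMem hnot]
  have hA'sa : ∀ y τ, IsSelfAdjoint (A' y τ) := by
    intro y τ
    by_cases hmem : (y, τ) ∈ M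
    · obtain ⟨j, hj, hs⟩ := hmem
      exact (hsock j hj y τ hs).2.1
    · have : A' y τ = 0 := by simp only [hA'_def, Set.indicator_of_notMem hmem]
      rw [this]; exact IsSelfAdjoint.zero 𝔸
  have hA'41 : ∀ j, j ≤ m → ∀ y τ, SideTouches (Ω j) y τ →
      W y τ = cfgExp η A' y τ ∧ ‖A' y τ‖ ≤ α₂ * ((L : ℝ) ^ j * η)⁻¹ := by
    intro j hj y τ hs
    obtain ⟨hAA, -, hWe⟩ := hsock j hj y τ hs
    exact ⟨hWe, by rw [hAA]; exact (hWA j hj (y, τ) hs).2⟩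
  -- global bound `‖A′‖ ≤ α₂η⁻¹`
  have hA'glob : ∀ y τ, ‖A' y τ‖ ≤ α₂ * η⁻¹ := by
    intro y τ
    by_cases hmem : (y, τ) ∈ M
    · obtain ⟨j, hj, hs⟩ := hmem
      have hLj : (1 : ℝ) ≤ (L : ℝ) ^ j := one_le_pow₀ hLr
      calc ‖A' y τ‖ ≤ α₂ * ((L : ℝ) ^ j * η)⁻¹ := (hA'41 j hj y τ hs).2
        _ = α₂ * η⁻¹ * ((L : ℝ) ^ j)⁻¹ := by rw [mul_inv]; ring
        _ ≤ α₂ * η⁻¹ * 1 := by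
            apply mul_le_mul_of_nonneg_left (inv_le_one_of_one_le₀ hLj) (by positivity)
        _ = α₂ * η⁻¹ := mul_one _
    · have : A' y τ = 0 := by simp only [hA'_def, Set.indicator_of_notMem hmem]
      rw [this, norm_zero]; positivity
  -- the in-edge (1.59) and the (1.42) clause for `A′`
  obtain ⟨h59a, h59g⟩ := H59 m hm1 hmk u W A' hu hW h129 hLan hA'sa hA'41 hA'0
  have h42 := H42 m hm1 hmk u W A' hu hW h129 hLan hA'sa hA'41 hA'0
  -- (1.40) for `U₀` and for `e^{iηA′}U₀` at the `m` levels
  have h40₀ : InAk L m η α₀ Ω U₀ := fun j hj => h33 j (hj.trans hmk)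
  have h40W : InAk L m η α₀ Ω (mulCfg W U₀) := by
    have h1 : InAk L m η α₀ Ω (mulCfg U' U₀) := fun j hj => h34 j (hj.trans hmk)
    have hui : ∀ x, u⁻¹ x ∈ U1 𝔸 := fun x => unitaryUnits_le_U1 ((unitaryUnits 𝔸).inv_mem (hu x))
    rw [mulCfg_eq_gaugeAct_of_mgauge_eq hW]
    exact (B8Ineq132.inAk_gaugeAct_iff L m η α₀ Ω hui _).2 h1
  have h40₁ : InAk L m η α₀ Ω (mulCfg (expCfg (iEta η A')) U₀) := by
    refine (inAk_congr_of_sideTouches L m η α₀ (V := mulCfg W U₀) fun j hj y τ hs => ?_).1 h40W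
    show W y τ * U₀ y τ = expCfg (iEta η A') y τ * U₀ y τ
    rw [(hA'41 j hj y τ hs).1, expCfg_iEta_eq_cfgExp]
  -- boundedness of the two weighted families and the gradient datum
  have hBa : Bdd L m η (-(1 : ℝ)) (fun j (b : Site d × Fin d) => SideTouches (Ω j) b.1 b.2) fun b => A' b.1 b.2 := by
    have e1 : (-(1 : ℝ)) = -((1 : ℕ) : ℝ) := by norm_num
    rw [e1]
    refine B8ScaledSupNorm.bdd_of_forall (c := α₂) fun j hj b hb => ?_
    have hs : 0 < (L : ℝ) ^ j * η := B8ScaledSupNorm.scale_pos hL1 hη j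
    rw [B8ScaledSupNorm.weight_neg_natCast L η 1 j, pow_one]
    calc (L : ℝ) ^ j * η * ‖A' b.1 b.2‖ ≤ (L : ℝ) ^ j * η * (α₂ * ((L : ℝ) ^ j * η)⁻¹) :=
        mul_le_mul_of_nonneg_left (hA'41 j hj b.1 b.2 hb).2 hs.le
      _ = α₂ := by field_simp
  have hU₀1 : ∀ x κ, U₀ x κ ∈ U1 𝔸 := fun x κ => unitaryUnits_le_U1 (hU₀ x κ)
  have hgrad : ∀ (y : Site d) (κ τ : Fin d), ‖covDerivFwd η U₀ κ (fun z => A' z τ) y‖ ≤ 2 * α₂ * η⁻¹ * η⁻¹ := by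
    intro y κ τ
    unfold covDerivFwd
    rw [norm_smul, norm_inv, Real.norm_eq_abs, abs_of_pos hη]
    have h1 : ‖conjR (U₀ y κ) (A' (y + e κ) τ) - A' y τ‖ ≤ α₂ * η⁻¹ + α₂ * η⁻¹ := by
      calc ‖conjR (U₀ y κ) (A' (y + e κ) τ) - A' y τ‖
          ≤ ‖conjR (U₀ y κ) (A' (y + e κ) τ)‖ + ‖A' y τ‖ := norm_sub_le _ _
        _ ≤ α₂ * η⁻¹ + α₂ * η⁻¹ := by
            rw [B8Ineq132.norm_conjR (hU₀1 y κ)]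
            exact add_le_add (hA'glob _ _) (hA'glob _ _)
    calc η⁻¹ * ‖conjR (U₀ y κ) (A' (y + e κ) τ) - A' y τ‖ ≤ η⁻¹ * (α₂ * η⁻¹ + α₂ * η⁻¹) :=
        mul_le_mul_of_nonneg_left h1 (by positivity)
      _ = 2 * α₂ * η⁻¹ * η⁻¹ := by ring
  have hBg : Bdd L m η (-(2 : ℝ)) (fun j (t : Fin d × Fin d × Site d) => SideTouches (Ω j) t.2.2 t.2.1)
      (fun t => covDerivFwd η U₀ t.1 (fun z => A' z t.2.1) t.2.2) := by
    have e2 : (-(2 : ℝ)) = -((2 : ℕ) : ℝ) := by norm_num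
    rw [e2]
    refine B8ScaledSupNorm.bdd_of_forall (c := 2 * α₂ * ((L : ℝ) ^ m) ^ 2) fun j hj t _ => ?_
    rw [B8ScaledSupNorm.weight_neg_natCast L η 2 j]
    have hLjm : (L : ℝ) ^ j ≤ (L : ℝ) ^ m := pow_le_pow_right₀ hLr hj
    have hLj0 : (0 : ℝ) ≤ (L : ℝ) ^ j := by positivity
    calc ((L : ℝ) ^ j * η) ^ 2 * ‖covDerivFwd η U₀ t.1 (fun z => A' z t.2.1) t.2.2‖
        ≤ ((L : ℝ) ^ j * η) ^ 2 * (2 * α₂ * η⁻¹ * η⁻¹) := mul_le_mul_of_nonneg_left (hgrad _ _ _) (by positivity)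
      _ = 2 * α₂ * ((L : ℝ) ^ j) ^ 2 := by field_simp
      _ ≤ 2 * α₂ * ((L : ℝ) ^ m) ^ 2 := by gcongr
  set g : ℝ := msup L m η (-(2 : ℝ)) (fun j (t : Fin d × Fin d × Site d) => SideTouches (Ω j) t.2.2 t.2.1)
      (fun t => covDerivFwd η U₀ t.1 (fun z => A' z t.2.1) t.2.2) with hg_def
  have hg0 : 0 ≤ g := B8ScaledSupNorm.msup_nonneg L m hη.le _ _ _
  have hg : ∀ j, j ≤ m → ∀ (y : Site d) (κ τ : Fin d), SideTouches (Ω j) y τ →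
      ((L : ℝ) ^ j * η) ^ 2 * ‖covDerivFwd η U₀ κ (fun z => A' z τ) y‖ ≤ g := by
    intro j hj y κ τ hs
    have h := B8ScaledSupNorm.weight_mul_norm_le_msup hBg hj (i := (κ, τ, y)) hs
    have hw : weight L η (-(2 : ℝ)) j = ((L : ℝ) ^ j * η) ^ 2 := by
      have e2 : (-(2 : ℝ)) = -((2 : ℕ) : ℝ) := by norm_num
      rw [e2, B8ScaledSupNorm.weight_neg_natCast L η 2 j]
    rw [hw] at h
    exact h
  -- PROPOSITION 3 at `m` levels for `A′` (n05-b's `prop3_norms_kLevel`)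
  obtain ⟨ha, -⟩ := prop3_normA_kLevel_src_γ hd2 hη hL hU₀ hA'sa hα₀ hα₁ hα₂ hg0 hα3 hα4 h16 hd5 hsmall hc₃
    hB₀ hside h50 hC₂ h61 (hbox m hmk) h40₀ h40₁ (fun j hj y τ hs => (hA'41 j hj y τ hs).2) hg h42 h59a h59g
  -- pointwise on the socket bond, and back to `A`
  have hpt := B8ScaledSupNorm.norm_le_of_msup_le hL1 hη hBa ha hj₀ (i := b₀) hb₀
  rw [Real.rpow_neg_one] at hpt
  obtain ⟨hAA, -, -⟩ := hsock j₀ hj₀ b₀.1 b₀.2 hb₀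
  rw [← hAA]
  exact hpt.trans (mul_le_mul_of_nonneg_right hc (by positivity))

end Reset

/-! ## §3 Theorem 4's existence clause at all levels, arbitrary `Lan`, sourced reset, edition γ — Theorem 8's existence core in γ -/

section Composition

variable {𝔸 : Type*} [CStarAlgebra 𝔸] [Nontrivial 𝔸]

/-- ★★ **THEOREM 4's EXISTENCE INDUCTION AT ALL LEVELS, GAUGE TRANSFORMATIONS CARRIED BY Ω₀, ARBITRARY GAUGE PREDICATE `Lan`, SOURCED RESET, EDITION γ** (datum class `Λb` a PARAMETER under print's law «box ⊂ Ω_{j−1}», (1.35) guarded the same way, (1.42) by dag-n05-e's `B8Eq142KLevelLocalGamma.H42_of_inAx_γ`; the sourced twin of `B8Thm4KLevelGamma.thm4_exists_all_levels_supp_landau138_γ` without boundary terms — the `Ω₀ = ℤᵈ` road) —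
`B8Thm4SupportLocal.thm4_exists_all_levels_supp` at `E j :=` the sides touching `Ω_j`, `S := Ω 0`, with `hP3 := hP3_gaugeFixed_of_b9_src` and the
(1.42) clause `B8Eq142KLevelLocal.H42_of_inAx` (both `Lan`-generic).  CONCLUSION: for every `m ≤ k` a unitary-valued `u` with `u = 1` off `Ω₀`,
(1.29) at `m` levels, `W = U′^{u⁻¹}` with `Lan m W` (`m ≥ 1`) and `W_b = e^{iηA_b}`, `A_b` self-adjoint, `‖A_b‖ ≤ c⋆(Lʲη)⁻¹` on the sides touching
`Ω_j`, `j ≤ m`, for ANY `c⋆ ≥ 5dLB₀(α₀ + α₁) + T_a + T_g` inside the windows.  REMAINING HYPOTHESES: Prop. 5's sockets AT `Lan` (`hP5base`,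
`hP5`), the SOURCED in-edge `H59src`, (1.33)/(1.34)/axial/(1.35)/(1.66)₀, geometry, windows.  At `Lan := IsLandau138W`, `T = 0` this is
`thm4_exists_all_levels_supp_landau138`; at `Lan := B8Eq138LandauZd.IsLandau146W … f` it is THEOREM 8's existence core ((1.146) with the
(1.62)-shape), the first brick of `B8Thm8Surviving.Thm8SurvivingAt` on the concrete carriers.
[cite: Balaban1985RegularSpaces, Thm 8 (1.146) p.101, Thm 4 p.88, (1.38) p.82, Prop. 3 p.87, Prop. 5 p.94, pp.94–95] -/
theorem thm4_exists_all_levels_supp_src_γ (hd2 : 2 ≤ d) {η : ℝ} (hη : 0 < η) {L : ℕ} (hL : 2 ≤ L) (k : ℕ)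
    {U₀ U' : Site d → Fin d → 𝔸ˣ} (hU₀ : ∀ x κ, U₀ x κ ∈ unitaryUnits 𝔸) (hU' : ∀ x κ, U' x κ ∈ unitaryUnits 𝔸)
    {α₀ α₁ α₄ B₀ cstar a : ℝ} (hα₀ : 0 < α₀) (hα₁ : 0 < α₁) (hα₄ : 0 ≤ α₄) (hB₀ : 0 ≤ B₀)
    {Ta Tg : ℝ} (hTa : 0 ≤ Ta) (hTg : 0 ≤ Tg) (hc : 5 * d * L * B₀ * (α₀ + α₁) + (Ta + Tg) ≤ cstar)
    (hs₁ : α₄ ≤ 1 / 84) (hs₂ : L * cstar ≤ 1 / 12) (ha : a ≤ 1 / 4) (ha2 : 2 * a ≤ cstar)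
    -- [3] Prop. 4's linearisation windows ONE LEVEL LOWER (edition γ)
    (hα3 : C0 d * ((L : ℝ) ^ 2 * α₀) ≤ 1 / 3) (hα4 : 4 * ((L : ℝ) ^ 2 * α₀) ≤ c2' d L)
    (h16 : 16 * (2 * (L * cstar) + 8 * α₄) ≤ 1) (hd5 : 5 * (2 * (L * cstar) + 8 * α₄) * ((d : ℝ) - 1) ≤ 4)
    (hsmall : Real.exp (4 * (800 * ((d : ℝ) + 1) ^ 2 * ((d : ℝ) + 4)) * ((L : ℝ) ^ 2 * α₀))
      * (1 + 8 * (131072 * ((d : ℝ) + 1) ^ 2) * ((L : ℝ) * (2 * (L * cstar) + 8 * α₄))) ≤ 2)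
    (hc₃ : 2 * ((L : ℝ) * (2 * (L * cstar) + 8 * α₄)) ≤ c3 d L) (hside : 36 * d * B₀ * (2 * (L * cstar) + 8 * α₄) ≤ 1 / 2)
    (h50 : 50 * d * (2 * (L * cstar) + 8 * α₄) ≤ 1) (hsmall₁ : (d : ℝ) * L * α₁ ≤ 1 / 8)
    (h16γ : 16 * ((L : ℝ) * (2 * (L * cstar) + 8 * α₄)) ≤ 1)
    {C₂ : ℝ} (hC₂ : 8 * (131072 * ((d : ℝ) + 1) ^ 2) * Real.exp (4 * (800 * ((d : ℝ) + 1) ^ 2 * ((d : ℝ) + 4)) * ((L : ℝ) ^ 2 * α₀)) * (L : ℝ) ^ 2 ≤ C₂)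
    (h61 : 2 * (2 * (L * cstar) + 8 * α₄) ^ 2 + 20 * d * α₀ * (2 * (L * cstar) + 8 * α₄)
      + 2 * C₂ * (2 * (L * cstar) + 8 * α₄) ^ 2 ≤ α₀ + α₁)
    (Ω : ℕ → Set (Site d)) (hΩ : ∀ j, Ω (j + 1) ⊆ Ω j) (Λs : ℕ → ℕ → Set (Site d)) (Λb : ℕ → ℕ → Set (Site d × Fin d))
    -- PRINT's box law (edition γ): the locality box of a level-`j` datum bond lies in `Ω_{j−1}` ((1.31); level 0: `Ω₀`)
    (hbox : ∀ m, m ≤ k → ∀ j, j ≤ m → ∀ c ∈ Λb m j, ∀ x, InBox (loK L j c.1) (bondHiK L j c.1 c.2) x → x ∈ Ω (j - 1))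
    (hclass : ∀ m, m ≤ k → ∀ j, j ≤ m → ∀ c ∈ Λb m j,
      (c.1 ∈ Λs m j ∧ c.1 + e c.2 ∈ Λs m j) ∨
      (∃ j', j = j' + 1 ∧ (∀ x, (L : ℤ) • c.1 ≤ x → x ≤ (L : ℤ) • c.1 + blockTop L → x ∈ Λs m j') ∧ c.1 + e c.2 ∈ Λs m j) ∨
      (∃ j', j = j' + 1 ∧ c.1 ∈ Λs m j ∧ (∀ x, (L : ℤ) • (c.1 + e c.2) ≤ x → x ≤ (L : ℤ) • (c.1 + e c.2) + blockTop L → x ∈ Λs m j')))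
    (h33 : InAk L k η α₀ Ω U₀) (h34 : InAk L k η α₀ Ω (mulCfg U' U₀))
    (hAx : ∀ m, m ≤ k → InAx L m (Λs m) U₀ (mulCfg U' U₀))
    -- (1.35) on every level-`j` bond whose locality box lies in `Ω_{j−1}` (print p. 77; edition γ)
    (h135 : ∀ j, j ≤ k → ∀ (z : Site d) (μ : Fin d), (∀ x, InBox (loK L j z) (bondHiK L j z μ) x → x ∈ Ω (j - 1)) →
      ‖(avgIter L (mulCfg U' U₀) j z μ : 𝔸) - (avgIter L U₀ j z μ : 𝔸)‖ ≤ α₁)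
    (h66 : ∀ b ∈ {b : Site d × Fin d | SideTouches (Ω 0) b.1 b.2}, ‖((U' b.1 b.2 : 𝔸ˣ) : 𝔸) - 1‖ ≤ a)
    (Lan : ℕ → (Site d → Fin d → 𝔸ˣ) → Prop)
    (hP5base : ∃ (v : Site d → 𝔸ˣ) (lam : Site d → 𝔸), (∀ x, v x ∈ unitaryUnits 𝔸) ∧ (∀ x, x ∉ Ω 0 → v x = 1) ∧
        (∀ j, j ≤ 1 → ∀ b ∈ {b : Site d × Fin d | SideTouches (Ω j) b.1 b.2}, (v b.1 : 𝔸) = ((gaugeExp lam b.1 : 𝔸ˣ) : 𝔸) ∧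
          (v (b.1 + e b.2) : 𝔸) = ((gaugeExp lam (b.1 + e b.2) : 𝔸ˣ) : 𝔸)) ∧
        (∀ j, j ≤ 1 → ∀ b ∈ {b : Site d × Fin d | SideTouches (Ω j) b.1 b.2},
          ‖lam b.1‖ ≤ α₄ ∧ ((L : ℝ) ^ j * η) * ‖covDerivFwd η U₀ b.2 lam b.1‖ ≤ α₄) ∧
        Lan 1 (mgauge U₀ v⁻¹ U') ∧ Restr129 L 1 (Λs 1) U₀ ((1 : Site d → 𝔸ˣ) * v))
    (hP5 : ∀ m, 1 ≤ m → m < k → ∀ (u₁ : Site d → 𝔸ˣ) (U₁ : Site d → Fin d → 𝔸ˣ) (A : Site d → Fin d → 𝔸),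
      (∀ x, u₁ x ∈ unitaryUnits 𝔸) → (∀ x, x ∉ Ω 0 → u₁ x = 1) → mgauge U₀ u₁ U₁ = U' → Restr129 L m (Λs m) U₀ u₁ →
      Lan m U₁ →
      (∀ j, j ≤ m → ∀ b ∈ {b : Site d × Fin d | SideTouches (Ω j) b.1 b.2},
        U₁ b.1 b.2 = cfgExp η A b.1 b.2 ∧ IsSelfAdjoint (A b.1 b.2) ∧ ‖A b.1 b.2‖ ≤ cstar * ((L : ℝ) ^ j * η)⁻¹) →
      ∃ (v : Site d → 𝔸ˣ) (lam : Site d → 𝔸), (∀ x, v x ∈ unitaryUnits 𝔸) ∧ (∀ x, x ∉ Ω 0 → v x = 1) ∧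
        (∀ j, j ≤ m + 1 → ∀ b ∈ {b : Site d × Fin d | SideTouches (Ω j) b.1 b.2}, (v b.1 : 𝔸) = ((gaugeExp lam b.1 : 𝔸ˣ) : 𝔸) ∧
          (v (b.1 + e b.2) : 𝔸) = ((gaugeExp lam (b.1 + e b.2) : 𝔸ˣ) : 𝔸)) ∧
        (∀ j, j ≤ m + 1 → ∀ b ∈ {b : Site d × Fin d | SideTouches (Ω j) b.1 b.2},
          ‖lam b.1‖ ≤ α₄ ∧ ((L : ℝ) ^ j * η) * ‖covDerivFwd η U₀ b.2 lam b.1‖ ≤ α₄) ∧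
        Lan (m + 1) (mgauge U₀ v⁻¹ U₁) ∧ Restr129 L (m + 1) (Λs (m + 1)) U₀ (u₁ * v))
    (H59src : ∀ m, 1 ≤ m → m ≤ k → ∀ (u : Site d → 𝔸ˣ) (W : Site d → Fin d → 𝔸ˣ) (A' : Site d → Fin d → 𝔸),
      (∀ x, u x ∈ unitaryUnits 𝔸) → mgauge U₀ u W = U' → Restr129 L m (Λs m) U₀ u → Lan m W →
      (∀ y τ, IsSelfAdjoint (A' y τ)) →
      (∀ j, j ≤ m → ∀ y τ, SideTouches (Ω j) y τ →
        W y τ = cfgExp η A' y τ ∧ ‖A' y τ‖ ≤ (2 * (L * cstar) + 8 * α₄) * ((L : ℝ) ^ j * η)⁻¹) →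
      (∀ y τ, (∀ j, j ≤ m → ¬ SideTouches (Ω j) y τ) → A' y τ = 0) →
      msup L m η (-(1 : ℝ)) (fun j (b : Site d × Fin d) => SideTouches (Ω j) b.1 b.2) (fun b => A' b.1 b.2)
          ≤ B₀ * (bondNorm L m η (-(3 : ℝ)) Ω (fun x μ => Jcur η U₀ A' μ x)
            + wsup 1 (fun p : {p : ℕ × (Site d × Fin d) // p.1 ≤ m ∧ p.2 ∈ Λb m p.1} =>
                linCovIter L U₀ (iEta η A') p.1.1 p.1.2.1 p.1.2.2)) + Ta ∧
        msup L m η (-(2 : ℝ)) (fun j (t : Fin d × Fin d × Site d) => SideTouches (Ω j) t.2.2 t.2.1)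
            (fun t => covDerivFwd η U₀ t.1 (fun z => A' z t.2.1) t.2.2)
          ≤ B₀ * (bondNorm L m η (-(3 : ℝ)) Ω (fun x μ => Jcur η U₀ A' μ x)
            + wsup 1 (fun p : {p : ℕ × (Site d × Fin d) // p.1 ≤ m ∧ p.2 ∈ Λb m p.1} =>
                linCovIter L U₀ (iEta η A') p.1.1 p.1.2.1 p.1.2.2)) + Tg) :
    ∀ m, m ≤ k → ∃ u : Site d → 𝔸ˣ, (∀ x, u x ∈ unitaryUnits 𝔸) ∧ (∀ x, x ∉ Ω 0 → u x = 1) ∧ Restr129 L m (Λs m) U₀ u ∧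
      ∃ W : Site d → Fin d → 𝔸ˣ, mgauge U₀ u W = U' ∧ (1 ≤ m → Lan m W) ∧
        ∃ A : Site d → Fin d → 𝔸, ∀ j, j ≤ m → ∀ b ∈ {b : Site d × Fin d | SideTouches (Ω j) b.1 b.2},
          W b.1 b.2 = cfgExp η A b.1 b.2 ∧ IsSelfAdjoint (A b.1 b.2) ∧ ‖A b.1 b.2‖ ≤ cstar * ((L : ℝ) ^ j * η)⁻¹ := by
  have hL1 : 1 ≤ L := le_trans (by norm_num) hL
  have hcstar : 0 ≤ cstar := le_trans (by positivity) hc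
  have hα₂ : 0 ≤ 2 * (L * cstar) + 8 * α₄ := by positivity
  have hE : ∀ j, {b : Site d × Fin d | SideTouches (Ω (j + 1)) b.1 b.2} ⊆ {b : Site d × Fin d | SideTouches (Ω j) b.1 b.2} :=
    fun j b hb => B8Eq140Level.sideTouches_mono (hΩ j) hb
  exact thm4_exists_all_levels_supp hL1 hη (Ω 0) hU₀ hU' hcstar hα₄ hs₁ hs₂ ha ha2
    (fun j => {b : Site d × Fin d | SideTouches (Ω j) b.1 b.2}) hE h66 Λs Lan
    hP5base hP5
    (hP3_gaugeFixed_of_b9_src_γ hd2 hη hL k hU₀ hU' hα₀ hα₁.le hα₄ hB₀ hTa hTg hc hα3 hα4 h16 hd5 hsmall hc₃ hside h50 hC₂ h61 Ω Λs Λb hbox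
      h33 h34 Lan
      (B8Eq142KLevelLocalGamma.H42_of_inAx_γ hd2 hη hL k hU₀ hα₀ hα₁ hα₂ hα3 hα4 h16γ hsmall hc₃ hsmall₁ Ω hΩ Λs Λb hbox hclass h33 h34
        hAx h135 Lan)
      H59src)

end Composition

#print axioms prop3_normA_kLevel_src_γ
#print axioms hP3_gaugeFixed_of_b9_src_γ
#print axioms thm4_exists_all_levels_supp_src_γ

end Literature.MathematicalPhysics.QuantumFieldTheory.Balaban1983to89.B8Prop3GaugeFixedKLevelSrcGamma

end
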